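import Summits.QuantumFields.YangMills.Theorems.UV3BranchExpansionRestrictedDensity
import HarnessLib

/-!
# UV3 ∕ N08 supply — THE RESTRICTED HYBRID TRANSPORT WEIGHT (lemma (A₁)∘(A₂) of the branch expansion): the part of product Haar measure on which a SET `S` of
# coarse bonds is GUARDED, pushed through the hybrid averaging `Ū^{S′}` (`S′ ⊆ S`), is at most `K^{|S′|}·(h(δ+δ′)^{L^{d−1}−1}∕h(δ′))^{|S|} • dV` — the per-pattern weight

LEAD seat `ym-ust-19936-w1` (gen 12) of crux stmt-QuantumFields-19936 `UnitScaleTilt.HistoryTailL`, cell `ym3-torus`; design note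
`Cruxes/HistoryTailL/HTopBranchExpansion.md` (19936 evidence #49), lemma (A); abstract letters ✓`Theorems/UV3BranchExpansionKernels`∕`…Domination` (p757891∕p758050).
RECORD CURRENCY (★★OWNER WORDS 84∕85): record-independent kinematics of the guarded block averaging (print's (0.4) with any small-loop average `ℰ`); read by NO row
and NO concluder of the χ-record `AlphaInputsT3ACv4RecChi`; SUPPLY for NODE O B3 (A-rows `fibre55Win`∕`fibre57LowOn`) and for Track A's N08 node (k-uniform
masses).  Nothing of hTop, of the record, of `HistoryTailL` or of rung R3 is proved here; rung R3 = SU(2) YM₃ on T³ — NOT d = 4, NOT infinite volume, NOT a mass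
gap, NOT the Clay problem.

THE POINT.  (A₁) is IN THE TREE: w8 g12's ✓p758345 `UV3BranchExpansionRestrictedDensity.map_restrict_guardAll_hybrid_le` — `((dU)↾G_S).map Ū^{S′} ≤
K^{|S′|}·dU{∀ c ∈ S guard-ADMITTING} • dV` for `S′ ⊆ S` (resampling of the private crossing bonds with the guard indicator kept inside: the smallness of the guard
survives POINTWISE as the probability of an admitting background).  This file does NOT re-prove it; it composes (A₁) with n08-w3's joint admitting bound (A₂)
✓`measure_forall_guardAdmitting_le` into the one-level letter that the stacking (A₃) ✓`UV3BranchExpansionDomination.map_restrict_iterate_le_prod_smul(_of_lt)` consumes: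
* §1 ★★ `smul_map_restrict_guardAll_hybrid_le` — **`h(δ′)^{|S|} • ((dU)↾{∀ c ∈ S, Small ℰ · c}).map Ū^{S′} ≤ (K^{|S′|} · h(δ+δ′)^{|S|·(L^{d−1}−1)}) • dV`** for every window
  radius `δ′` (`δ = ℰ.δ`, `h(r) = Haar{dist1 < r}`), every group, every small-loop average, every `S′ ⊆ S`, standing range — the per-pattern one-level weight
  `K^{|S′|}·(h(δ+δ′)^{L^{d−1}−1}∕h(δ′))^{|S|}`: exponent = number of constrained bonds, VOLUME-FREE (this is what makes the exploration-tree count (C) K-uniform).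
* §2 ★★ the same at the [B10] slot's averaging `avOfPrint N S₀ j` on `SU(N)` (exponent `L² − 1`, guard radius `δ_N = min(1∕3, π∕N)`).
[folklore] measure theory over the lineage's parts BY IMPORT; (H_K) is a HYPOTHESIS here (discharged at `N = 2` by ✓`…GuardCoreLawSU2`∕`…GuardKStepMassesSU2Record`);
0 `sorry`, 0 `def`, 0 `instance`; standard axioms.
-/

set_option autoImplicit false

noncomputable section

open MeasureTheory Function
open scoped ENNReal

namespace Summit.QuantumFields.YangMills.Theorems.UV3GuardHybridRestrictedTransport

open Literature.MathematicalPhysics.QuantumFieldTheory.Balaban1983to89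
open Literature.MathematicalPhysics.QuantumFieldTheory.Balaban1983to89.AveragingRT (axialAvg)
open Literature.MathematicalPhysics.QuantumFieldTheory.Balaban1983to89.BlockAveraging (Small avgFun)
open Literature.MathematicalPhysics.QuantumFieldTheory.Balaban1983to89.BlockAveragingHaarAC (centralBond)
open Summit.QuantumFields.YangMills.BalabanUVNodes.N08HaarCompatibilityGuardAdmitting (measure_forall_guardAdmitting_le)
open Summit.QuantumFields.YangMills.Theorems.UV3BranchExpansionRestrictedDensity (map_restrict_guardAll_hybrid_le)

/-! ## §1 The restricted hybrid transport weight: (A₁) ∘ (A₂) -/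

section Generic

variable {P : Params} {j : ℕ} {G : Type*} [GaugeGroup G] (ℰ : LoopAverage G) [DecidableEq (PBond P (j + 1))] [MeasurableSpace G] [RegularGaugeGroup G]
  [HaarData G]

/-- ★★ **THE RESTRICTED HYBRID TRANSPORT WEIGHT (lemma (A₁)∘(A₂), cleared denominators)** over w8 g12's ✓`map_restrict_guardAll_hybrid_le`: for `S′ ⊆ S` and every window radius `δ′`,
`h(δ′)^{|S|} • ((dU)↾G_S).map Ū^{S′} ≤ (K^{|S′|} · h(δ + δ′)^{|S|·(L^{d−1}−1)}) • dV` (`δ = ℰ.δ`, `h(r) = Haar{dist1 < r}`) — i.e. the per-pattern weight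
`K^{|S′|}·(h(δ+δ′)^{L^{d−1}−1}∕h(δ′))^{|S|}`, exponent = number of constrained bonds, uniformly in the lattice.
[cite: Balaban1987RG1, (0.4) p.253 (the typed averaging; bookkeeping — the bound is NOT in print)] -/
theorem smul_map_restrict_guardAll_hybrid_le (hj : j + 1 ≤ P.m + P.K) (hE : ∀ n, Measurable fun W : Fin (n + 1) → G => ℰ.E W) (S S' : Finset (PBond P (j + 1)))
    (hS' : S' ⊆ S) {K : ℝ≥0∞} (hK1 : 1 ≤ K) (hKtop : K ≠ ∞)
    (hK : ∀ c ∈ S', ∀ U : GaugeField P j G, (∃ g : G, Small ℰ (update U (centralBond c) g) c) →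
      (HaarData.haar : Measure G).map (fun g => avgFun ℰ (update U (centralBond c) g) c) ≤ K • (HaarData.haar : Measure G))
    (δ' : ℝ) :
    (HaarData.haar : Measure G) {g : G | dist1 g < δ'} ^ S.card •
        ((fieldMeasure P j G).restrict {U : GaugeField P j G | ∀ c ∈ S, Small ℰ U c}).map
          (fun U : GaugeField P j G => (fun c => if c ∈ S' then avgFun ℰ U c else axialAvg U c : GaugeField P (j + 1) G)) ≤
      (K ^ S'.card * (HaarData.haar : Measure G) {g : G | dist1 g < ℰ.δ + δ'} ^ (S.card * (P.L ^ (P.d - 1) - 1))) • fieldMeasure P (j + 1) G := by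
  have h := map_restrict_guardAll_hybrid_le ℰ hj hE S S' hS' hK1 hKtop hK
  have hadm := measure_forall_guardAdmitting_le ℰ hj δ' S
  refine Measure.le_iff.2 fun s _ => ?_
  have hs := h s
  simp only [Measure.smul_apply, smul_eq_mul] at hs ⊢
  calc (HaarData.haar : Measure G) {g : G | dist1 g < δ'} ^ S.card *
        ((fieldMeasure P j G).restrict {U : GaugeField P j G | ∀ c ∈ S, Small ℰ U c}).map
          (fun U : GaugeField P j G => (fun c => if c ∈ S' then avgFun ℰ U c else axialAvg U c : GaugeField P (j + 1) G)) s
      ≤ (HaarData.haar : Measure G) {g : G | dist1 g < δ'} ^ S.card *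
          (K ^ S'.card * fieldMeasure P j G {U : GaugeField P j G | ∀ c ∈ S, ∃ g : G, Small ℰ (update U (centralBond c) g) c} *
            fieldMeasure P (j + 1) G s) := mul_le_mul' le_rfl hs
    _ = K ^ S'.card * ((HaarData.haar : Measure G) {g : G | dist1 g < δ'} ^ S.card *
          fieldMeasure P j G {U : GaugeField P j G | ∀ c ∈ S, ∃ g : G, Small ℰ (update U (centralBond c) g) c}) * fieldMeasure P (j + 1) G s := by ring
    _ ≤ K ^ S'.card * (HaarData.haar : Measure G) {g : G | dist1 g < ℰ.δ + δ'} ^ (S.card * (P.L ^ (P.d - 1) - 1)) * fieldMeasure P (j + 1) G s :=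
        mul_le_mul' (mul_le_mul' le_rfl hadm) le_rfl

end Generic

/-! ## §2 At the [B10] slot's averaging `avOfPrint N S₀ j` on `SU(N)` -/

section Slot

open Literature.MathematicalPhysics.QuantumFieldTheory.Balaban1985CMP102.Setting (Scales)
open Literature.MathematicalPhysics.QuantumFieldTheory.Balaban1983to89.ExpMeanLog (expMeanLogSU expMeanLogSU_δ measurable_expMeanLogSU_E)
open Literature.MathematicalPhysics.QuantumFieldTheory.Balaban1983to89.Node00 (SU)

variable (N : ℕ) [NeZero N] {L : ℕ}

/-- ★★★ **AT THE SLOT** (the printed exp-mean-log guard of radius `δ_N = min(1∕3, π∕N)` on `SU(N)`, every `N`, standing range, `d = 3` so the exponent is `L² − 1`): under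
(H_K) at the bonds of `S′`, for every window radius `δ′`,
`h(δ′)^{|S|} • ((dU)↾{∀ c ∈ S, Small · c}).map Ū^{S′} ≤ (K^{|S′|}·h(δ_N + δ′)^{|S|(L^{d−1}−1)}) • dV` for the hybrid of print's averaging on `S′` and the axial averaging off `S′`.
[cite: Balaban1985UV3, (2) p.256; Balaban1985Averaging, (15) p.19; Balaban1987RG1, (0.4) p.253 (bookkeeping — the bound is NOT in print)] -/
theorem smul_map_restrict_guardAll_hybrid_avOfPrint_le (S₀ : Scales L) {j : ℕ} (hj : j + 1 ≤ S₀.P.m + S₀.P.K) [DecidableEq (PBond S₀.P (j + 1))]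
    (S S' : Finset (PBond S₀.P (j + 1))) (hS' : S' ⊆ S) {K : ℝ≥0∞} (hK1 : 1 ≤ K) (hKtop : K ≠ ∞)
    (hK : ∀ c ∈ S', ∀ U : GaugeField S₀.P j (SU N),
      (∃ g : SU N, Small (expMeanLogSU : LoopAverage (SU N)) (update U (centralBond c) g) c) →
        (HaarData.haar : Measure (SU N)).map (fun g => avgFun (expMeanLogSU : LoopAverage (SU N)) (update U (centralBond c) g) c) ≤
          K • (HaarData.haar : Measure (SU N)))
    (δ' : ℝ) :
    (HaarData.haar : Measure (SU N)) {g : SU N | dist1 g < δ'} ^ S.card •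
        ((fieldMeasure S₀.P j (SU N)).restrict {U : GaugeField S₀.P j (SU N) | ∀ c ∈ S, Small (expMeanLogSU : LoopAverage (SU N)) U c}).map
          (fun U : GaugeField S₀.P j (SU N) =>
            (fun c => if c ∈ S' then avgFun (expMeanLogSU : LoopAverage (SU N)) U c else axialAvg U c : GaugeField S₀.P (j + 1) (SU N))) ≤
      (K ^ S'.card * (HaarData.haar : Measure (SU N)) {g : SU N | dist1 g < min (1 / 3) (Real.pi / N) + δ'} ^ (S.card * (S₀.P.L ^ (S₀.P.d - 1) - 1))) •
        fieldMeasure S₀.P (j + 1) (SU N) := by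
  have h := smul_map_restrict_guardAll_hybrid_le (expMeanLogSU : LoopAverage (SU N)) hj measurable_expMeanLogSU_E S S' hS' hK1 hKtop hK δ'
  rw [expMeanLogSU_δ, Fintype.card_fin] at h
  exact h

end Slot

end Summit.QuantumFields.YangMills.Theorems.UV3GuardHybridRestrictedTransport

end
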